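import Mathlib
import Summits.ResolutionOfSingularities.ResolutionOfSingularities.Theorems.HomologicalConductorPersistenceKC3UpperIdeal
import HarnessLib

/-!
# Crux `Persistence` (stmt-ResolutionOfSingularities-16484), chain W4.4b — K-C3 K2-LOWER, part 3/4:
# the `E₆` curve `k[z,t]/(z³ + t⁴) ↪ k[τ]` (`z ↦ −τ⁴`, `t ↦ τ³`) and its conductor `⊇ τ⁶·k[τ]`

Route `ResolutionOfSingularities/HomologicalConductor`, chain W4.4b (cell `res-hironaka`), crux `Persistence`
(stmt-ResolutionOfSingularities-16484), KILL CANDIDATE K-C3, item K2-LOWER made UNCONDITIONAL (res-L1-w44b-stub-2 gen 4).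
`[OURS · L1 w44b]`; NOT a statement of the manuscript under review (Hironaka 2017), no statement of that manuscript is
used; AI-written, weaker than expert review.

Conventions of res-type-010's `…KC3Upper` / `…KC3UpperIdeal` (p527657 / p528919): `k[z,t] = MvPolynomial (Fin 2) k`
(`z = X 0`, `t = X 1`), the TEST MAP `θ : z ↦ −τ⁴, t ↦ τ³` into `k[τ] = Polynomial k`
(`MvPolynomial.aeval ![-(X ^ 4), X ^ 3]`), the threefold `S = k[x,y,z,t] = MvPolynomial (Fin 4) k`,
`f = X 0 * X 1 - X 2 ^ 3 - X 3 ^ 4`, retraction `π = aeval ![0, 0, X 0, X 1]`, inclusion `ι = aeval ![X 2, X 3]`.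

## Content

* §1 **KERNEL**: `θ g = 0 ⇒ g ∈ (z³ + t⁴)` (`mem_span_of_test_eq_zero`).  Normal form
  `g ≡ r₀(t) + r₁(t) z + r₂(t) z² (mod z³ + t⁴)` with `rᵢ ∈ k[T]` (`exists_normalForm`, induction on `g`,
  `z³ ≡ −t⁴`), `θ(rᵢ(t)) = expand₃ rᵢ`, and the coefficients of `τ^{3M + 4i}` of `Σᵢ expand₃(rᵢ)·(−τ⁴)ⁱ` read off
  `rᵢ` one at a time (the exponents `4i`, `i = 0,1,2`, are distinct mod `3`).
* §2 **IMAGE**: `τ⁶·k[τ] ⊆ θ(k[z,t])` (`exists_test_eq_X_pow_six_mul`: every `n ≥ 6` is `3i + 4j`).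
* §3 **THE CURVE STAGE OF THE TOWER** `C₂ = (S′/(F′))/(x̄)` with `S′ = k[x,z,t] = MvPolynomial (Fin 3) k`,
  `F′ = x² − z³ − t⁴` (the middle stage `k[x,y,z,t]/(xy − h, x − y) ≅ S′/(F′)`; `C₂ = k[z,t]/(z³+t⁴)`): the
  substitution `x ↦ 0, z ↦ −τ⁴, t ↦ τ³` descends to an INJECTIVE ring map `ψ : C₂ → k[τ]` whose image contains
  `τ⁶·k[τ]` (`exists_ringHom_curveStage`) — exactly the input of `…PersistenceConductorStable` (part 2/4), whence
  `t̄², z̄t̄, z̄² ∈ ca²(C₂)` in part 4/4.  Everything def-free: `F′`, `a₁ = x̄` are carried as variables with their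
  defining equations.  (Iterated quotients are kept to depth two: a third nested quotient of `MvPolynomial` exceeds
  Lean's instance-synthesis budget, so the tower's first stage is reached through `S′/(F′) ≅ (S/(f))/(x̄ − ȳ)` in
  part 4/4.)

References (mechanism only): res-L1-w44b-plan-1 CHAIN w44b v13.3 §V13.11 (K-C3 ledger); res-type-010 p527657/p528919 (OURS).
-/

noncomputable section

-- single-problem summit: the doubled namespace component `ResolutionOfSingularities` is forced
set_option linter.dupNamespace false

namespace Summit.ResolutionOfSingularities.ResolutionOfSingularities.Theorems.HomologicalConductor.KC3Lower

open MvPolynomial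
open Summit.ResolutionOfSingularities.ResolutionOfSingularities.Theorems.HomologicalConductor.KC3Upper

universe u

section Curve

variable (k : Type u) [Field k]

/-! ## §1 The kernel of the test map `θ : k[z,t] → k[τ]` is `(z³ + t⁴)` -/

/-- `θ(r(t)) = expand₃ r` for `r ∈ k[T]` substituted at `t = X 1`. [folklore] -/
theorem test_aeval_X_one (r : Polynomial k) :
    (MvPolynomial.aeval (R := k) (![-(Polynomial.X ^ 4), Polynomial.X ^ 3] : Fin 2 → Polynomial k))
        (Polynomial.aeval (X 1 : MvPolynomial (Fin 2) k) r) = Polynomial.expand k 3 r := by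
  have h : ((MvPolynomial.aeval (R := k) (![-(Polynomial.X ^ 4), Polynomial.X ^ 3] : Fin 2 → Polynomial k)).comp
      (Polynomial.aeval (X 1 : MvPolynomial (Fin 2) k))) = Polynomial.expand k 3 := by
    refine Polynomial.algHom_ext ?_
    simp [Polynomial.expand_X]
  exact congrArg (fun φ : Polynomial k →ₐ[k] Polynomial k => φ r) h

/-- `θ(z³ + t⁴) = 0`. [folklore] -/
theorem test_h :
    (MvPolynomial.aeval (R := k) (![-(Polynomial.X ^ 4), Polynomial.X ^ 3] : Fin 2 → Polynomial k))
        (X 0 ^ 3 + X 1 ^ 4 : MvPolynomial (Fin 2) k) = 0 := by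
  simp
  ring

/-- `θ` kills the ideal `(z³ + t⁴)`. [folklore] -/
theorem test_eq_zero_of_mem_span {u : MvPolynomial (Fin 2) k}
    (hu : u ∈ Ideal.span ({X 0 ^ 3 + X 1 ^ 4} : Set (MvPolynomial (Fin 2) k))) :
    (MvPolynomial.aeval (R := k) (![-(Polynomial.X ^ 4), Polynomial.X ^ 3] : Fin 2 → Polynomial k)) u = 0 := by
  obtain ⟨v, rfl⟩ := Ideal.mem_span_singleton'.mp hu
  rw [map_mul, test_h, mul_zero]

/-- **Normal form modulo `z³ + t⁴`**: every `g ∈ k[z,t]` is `≡ r₀(t) + r₁(t)·z + r₂(t)·z²` with `rᵢ ∈ k[T]`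
(division by the monic-in-`z` polynomial `z³ + t⁴`, as an induction on `g`). [folklore] -/
theorem exists_normalForm (g : MvPolynomial (Fin 2) k) :
    ∃ r : Fin 3 → Polynomial k,
      g - ∑ i : Fin 3, Polynomial.aeval (X 1 : MvPolynomial (Fin 2) k) (r i) * X 0 ^ (i : ℕ) ∈
        Ideal.span ({X 0 ^ 3 + X 1 ^ 4} : Set (MvPolynomial (Fin 2) k)) := by
  induction g using MvPolynomial.induction_on with
  | C a =>
    refine ⟨![Polynomial.C a, 0, 0], ?_⟩
    simp [Fin.sum_univ_three]
  | add p q hp hq =>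
    obtain ⟨rp, hp⟩ := hp
    obtain ⟨rq, hq⟩ := hq
    refine ⟨rp + rq, ?_⟩
    have : p + q - ∑ i : Fin 3, Polynomial.aeval (X 1 : MvPolynomial (Fin 2) k) ((rp + rq) i) * X 0 ^ (i : ℕ) =
        (p - ∑ i : Fin 3, Polynomial.aeval (X 1 : MvPolynomial (Fin 2) k) (rp i) * X 0 ^ (i : ℕ)) +
        (q - ∑ i : Fin 3, Polynomial.aeval (X 1 : MvPolynomial (Fin 2) k) (rq i) * X 0 ^ (i : ℕ)) := by
      simp only [Pi.add_apply, map_add, add_mul, Finset.sum_add_distrib]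
      ring
    rw [this]
    exact Ideal.add_mem _ hp hq
  | mul_X p i hp =>
    obtain ⟨r, hr⟩ := hp
    have hi : i = 0 ∨ i = 1 := by fin_cases i <;> simp
    rcases hi with rfl | rfl
    · -- multiplication by `z = X 0`: `z³ ≡ −t⁴`
      refine ⟨![-(r 2) * Polynomial.X ^ 4, r 0, r 1], ?_⟩
      have hid : p * X 0 - ∑ i : Fin 3, Polynomial.aeval (X 1 : MvPolynomial (Fin 2) k)
            ((![-(r 2) * Polynomial.X ^ 4, r 0, r 1] : Fin 3 → Polynomial k) i) * X 0 ^ (i : ℕ) =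
          (p - ∑ i : Fin 3, Polynomial.aeval (X 1 : MvPolynomial (Fin 2) k) (r i) * X 0 ^ (i : ℕ)) * X 0 +
            Polynomial.aeval (X 1 : MvPolynomial (Fin 2) k) (r 2) * (X 0 ^ 3 + X 1 ^ 4) := by
        simp only [Fin.sum_univ_three, Matrix.cons_val_zero, Matrix.cons_val_one, Matrix.head_cons,
          Matrix.cons_val_two, Matrix.tail_cons, map_mul, map_neg, map_pow, Polynomial.aeval_X, Fin.val_zero,
          Fin.val_one, Fin.val_two, pow_zero, pow_one]
        ring
      rw [hid]
      exact Ideal.add_mem _ (Ideal.mul_mem_right _ _ hr)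
        (Ideal.mul_mem_left _ _ (Ideal.subset_span (Set.mem_singleton _)))
    · -- multiplication by `t = X 1`
      refine ⟨fun j => r j * Polynomial.X, ?_⟩
      have hid : p * X 1 - ∑ i : Fin 3, Polynomial.aeval (X 1 : MvPolynomial (Fin 2) k) (r i * Polynomial.X) *
            X 0 ^ (i : ℕ) =
          (p - ∑ i : Fin 3, Polynomial.aeval (X 1 : MvPolynomial (Fin 2) k) (r i) * X 0 ^ (i : ℕ)) * X 1 := by
        simp only [map_mul, Polynomial.aeval_X, Finset.sum_mul, sub_mul]
        refine congrArg₂ _ rfl (Finset.sum_congr rfl fun i _ => ?_)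
        ring
      rw [hid]
      exact Ideal.mul_mem_right _ _ hr

/-- Arithmetic of the exponents `3M + 4i₀ − 4i`: divisible by `3` iff `i = i₀` (`i, i₀ < 3`). [folklore] -/
theorem coeff_aux (c : ℕ → k) (M : ℕ) {i i₀ : ℕ} (hi : i < 3) (hi₀ : i₀ < 3) :
    (if 4 * i ≤ 3 * M + 4 * i₀ then
        (if 3 ∣ 3 * M + 4 * i₀ - 4 * i then c ((3 * M + 4 * i₀ - 4 * i) / 3) else 0)
      else 0) = if i = i₀ then c M else 0 := by
  interval_cases i <;> interval_cases i₀ <;> split_ifs <;>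
    first | rfl | (exfalso; omega) | (congr 1; omega)

/-- The coefficient of `τ^{3M + 4 i₀}` in `Σᵢ expand₃(rᵢ)·(−τ⁴)ⁱ` is `(−1)^{i₀}·(r_{i₀})_M`. [folklore] -/
theorem coeff_sum_expand (r : Fin 3 → Polynomial k) (M : ℕ) (i₀ : Fin 3) :
    (∑ i : Fin 3, Polynomial.expand k 3 (r i) * (-(Polynomial.X : Polynomial k) ^ 4) ^ (i : ℕ)).coeff
        (3 * M + 4 * (i₀ : ℕ)) = (-1) ^ (i₀ : ℕ) * (r i₀).coeff M := by
  have hterm : ∀ i : Fin 3, (Polynomial.expand k 3 (r i) * (-(Polynomial.X : Polynomial k) ^ 4) ^ (i : ℕ)).coeff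
      (3 * M + 4 * (i₀ : ℕ)) = (-1) ^ (i : ℕ) * (if (i : ℕ) = i₀ then (r i).coeff M else 0) := by
    intro i
    rw [← coeff_aux k (fun n => (r i).coeff n) M i.2 i₀.2, neg_pow, ← pow_mul,
      show ((-1 : Polynomial k) ^ (i : ℕ)) = Polynomial.C ((-1 : k) ^ (i : ℕ)) by simp, mul_left_comm,
      Polynomial.coeff_C_mul, Polynomial.coeff_mul_X_pow', Polynomial.coeff_expand (by norm_num : 0 < 3)]
  rw [Polynomial.finsetSum_coeff, Finset.sum_congr rfl fun i _ => hterm i]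
  fin_cases i₀ <;> simp [Fin.sum_univ_three]

/-- **KERNEL LEMMA**: if `g(−τ⁴, τ³) = 0` then `g ∈ (z³ + t⁴)` — i.e. `k[z,t]/(z³ + t⁴) → k[τ]` is injective.
[folklore] -/
theorem mem_span_of_test_eq_zero (g : MvPolynomial (Fin 2) k)
    (hg : (MvPolynomial.aeval (R := k) (![-(Polynomial.X ^ 4), Polynomial.X ^ 3] : Fin 2 → Polynomial k)) g = 0) :
    g ∈ Ideal.span ({X 0 ^ 3 + X 1 ^ 4} : Set (MvPolynomial (Fin 2) k)) := by
  obtain ⟨r, hr⟩ := exists_normalForm k g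
  -- the normal form maps to `Σ expand₃(rᵢ) (−τ⁴)ⁱ`, which must vanish
  have hE : (∑ i : Fin 3, Polynomial.expand k 3 (r i) * (-(Polynomial.X : Polynomial k) ^ 4) ^ (i : ℕ)) = 0 := by
    have h0 := test_eq_zero_of_mem_span k hr
    rw [map_sub, hg, zero_sub, neg_eq_zero, map_sum] at h0
    simpa only [map_mul, map_pow, test_aeval_X_one, MvPolynomial.aeval_X, Matrix.cons_val_zero] using h0
  have hr0 : ∀ i : Fin 3, r i = 0 := fun i₀ => Polynomial.ext fun M => by
    have h := coeff_sum_expand k r M i₀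
    rw [hE, Polynomial.coeff_zero] at h
    have h1 : ((-1 : k) ^ (i₀ : ℕ)) ≠ 0 := pow_ne_zero _ (neg_ne_zero.mpr one_ne_zero)
    simpa [h1] using h.symm
  simpa [hr0] using hr

/-! ## §2 The image of the test map contains `τ⁶·k[τ]` -/

/-- Every `n ≥ 6` is of the form `3i + 4j`. [folklore] -/
theorem exists_three_four (n : ℕ) : ∃ i j : ℕ, 3 * i + 4 * j = n + 6 := by
  have h3 : n % 3 < 3 := Nat.mod_lt _ (by norm_num)
  have hn := Nat.div_add_mod n 3
  interval_cases h : n % 3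
  · exact ⟨n / 3 + 2, 0, by omega⟩
  · exact ⟨n / 3 + 1, 1, by omega⟩
  · exact ⟨n / 3, 2, by omega⟩

/-- **IMAGE LEMMA**: `τ⁶ · d ∈ θ(k[z,t])` for every `d ∈ k[τ]` (`τ^{3i+4j} = θ(tⁱ (−z)ʲ)`). [folklore] -/
theorem exists_test_eq_X_pow_six_mul (d : Polynomial k) :
    ∃ g : MvPolynomial (Fin 2) k,
      (MvPolynomial.aeval (R := k) (![-(Polynomial.X ^ 4), Polynomial.X ^ 3] : Fin 2 → Polynomial k)) g =
        Polynomial.X ^ 6 * d := by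
  induction d using Polynomial.induction_on' with
  | add p q hp hq =>
    obtain ⟨gp, hp⟩ := hp
    obtain ⟨gq, hq⟩ := hq
    exact ⟨gp + gq, by rw [map_add, hp, hq, mul_add]⟩
  | monomial n a =>
    obtain ⟨i, j, hij⟩ := exists_three_four n
    refine ⟨C a * X 1 ^ i * (-X 0) ^ j, ?_⟩
    simp only [map_mul, map_pow, map_neg, MvPolynomial.algHom_C, Polynomial.algebraMap_eq, MvPolynomial.aeval_X,
      Matrix.cons_val_one, Matrix.cons_val_zero, neg_neg, ← pow_mul, ← Polynomial.C_mul_X_pow_eq_monomial]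
    rw [mul_assoc, ← pow_add, show 3 * i + 4 * j = 6 + n by omega, pow_add]
    ring

end Curve

/-! ## §3 The curve stage `C₂ = (S′/(x² − h))/(x̄)` of the K-C3 tower and its parametrisation `ψ`

Here `S′ = k[x,z,t] = MvPolynomial (Fin 3) k` (`x = X 0`, `z = X 1`, `t = X 2`), `F′ = x² − z³ − t⁴` (the middle stage
`k[x,y,z,t]/(xy − h, x − y) ≅ S′/(F′)` of the tower), retraction `π′ : x ↦ 0, z ↦ X 0, t ↦ X 1` onto `k[z,t]`, inclusion
`ι′ : z ↦ X 1, t ↦ X 2`, and the substitution `x ↦ 0, z ↦ −τ⁴, t ↦ τ³` into `k[τ]`. -/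

section CurveStage

variable (k : Type u) [Field k]

/-- `g − ι′(π′ g) ∈ (x)` in `k[x,z,t]`. [folklore] -/
theorem sub_inclusion_retraction_mem₃ (g : MvPolynomial (Fin 3) k) :
    g - (MvPolynomial.aeval (![X 1, X 2] : Fin 2 → MvPolynomial (Fin 3) k))
        ((MvPolynomial.aeval (![0, X 0, X 1] : Fin 3 → MvPolynomial (Fin 2) k)) g) ∈
      Ideal.span ({X 0} : Set (MvPolynomial (Fin 3) k)) := by
  induction g using MvPolynomial.induction_on with
  | C r => simp
  | add p q hp hq =>
    have : p + q - (MvPolynomial.aeval (![X 1, X 2] : Fin 2 → MvPolynomial (Fin 3) k))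
        ((MvPolynomial.aeval (![0, X 0, X 1] : Fin 3 → MvPolynomial (Fin 2) k)) (p + q)) =
        (p - (MvPolynomial.aeval (![X 1, X 2] : Fin 2 → MvPolynomial (Fin 3) k))
          ((MvPolynomial.aeval (![0, X 0, X 1] : Fin 3 → MvPolynomial (Fin 2) k)) p)) +
        (q - (MvPolynomial.aeval (![X 1, X 2] : Fin 2 → MvPolynomial (Fin 3) k))
          ((MvPolynomial.aeval (![0, X 0, X 1] : Fin 3 → MvPolynomial (Fin 2) k)) q)) := by
      simp only [map_add]; ring
    rw [this]
    exact Ideal.add_mem _ hp hq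
  | mul_X p i hp =>
    have hX : ∀ j : Fin 3, (X j : MvPolynomial (Fin 3) k) -
        (MvPolynomial.aeval (![X 1, X 2] : Fin 2 → MvPolynomial (Fin 3) k))
          ((MvPolynomial.aeval (![0, X 0, X 1] : Fin 3 → MvPolynomial (Fin 2) k)) (X j : MvPolynomial (Fin 3) k)) ∈
        Ideal.span ({X 0} : Set (MvPolynomial (Fin 3) k)) := by
      intro j
      fin_cases j <;> simp
    have : p * X i - (MvPolynomial.aeval (![X 1, X 2] : Fin 2 → MvPolynomial (Fin 3) k))
        ((MvPolynomial.aeval (![0, X 0, X 1] : Fin 3 → MvPolynomial (Fin 2) k)) (p * X i)) =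
        (p - (MvPolynomial.aeval (![X 1, X 2] : Fin 2 → MvPolynomial (Fin 3) k))
          ((MvPolynomial.aeval (![0, X 0, X 1] : Fin 3 → MvPolynomial (Fin 2) k)) p)) * X i +
        (MvPolynomial.aeval (![X 1, X 2] : Fin 2 → MvPolynomial (Fin 3) k))
          ((MvPolynomial.aeval (![0, X 0, X 1] : Fin 3 → MvPolynomial (Fin 2) k)) p) *
          (X i - (MvPolynomial.aeval (![X 1, X 2] : Fin 2 → MvPolynomial (Fin 3) k))
            ((MvPolynomial.aeval (![0, X 0, X 1] : Fin 3 → MvPolynomial (Fin 2) k))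
              (X i : MvPolynomial (Fin 3) k))) := by
      simp only [map_mul]
      ring
    rw [this]
    exact Ideal.add_mem _ (Ideal.mul_mem_right _ _ hp) (Ideal.mul_mem_left _ _ (hX i))

/-- `π′ ∘ ι′ = id` on `k[z,t]`. [folklore] -/
theorem retraction_comp_inclusion₃ (s : MvPolynomial (Fin 2) k) :
    (MvPolynomial.aeval (![0, X 0, X 1] : Fin 3 → MvPolynomial (Fin 2) k))
      ((MvPolynomial.aeval (![X 1, X 2] : Fin 2 → MvPolynomial (Fin 3) k)) s) = s := by
  have h : (MvPolynomial.aeval (![0, X 0, X 1] : Fin 3 → MvPolynomial (Fin 2) k)).comp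
      (MvPolynomial.aeval (![X 1, X 2] : Fin 2 → MvPolynomial (Fin 3) k)) = AlgHom.id k _ := by
    refine MvPolynomial.algHom_ext fun i => ?_
    fin_cases i <;> simp
  exact AlgHom.congr_fun h s

/-- The test map composed with the retraction `π′` is the substitution `x ↦ 0, z ↦ −τ⁴, t ↦ τ³`. [folklore] -/
theorem test_comp_retraction₃ :
    ((MvPolynomial.aeval (R := k) (![-(Polynomial.X ^ 4), Polynomial.X ^ 3] : Fin 2 → Polynomial k)).comp
        (MvPolynomial.aeval (![0, X 0, X 1] : Fin 3 → MvPolynomial (Fin 2) k))) =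
      MvPolynomial.aeval (R := k) (![0, -(Polynomial.X ^ 4), Polynomial.X ^ 3] : Fin 3 → Polynomial k) := by
  refine MvPolynomial.algHom_ext fun i => ?_
  fin_cases i <;> simp

/-- The substitution `x ↦ 0, z ↦ −τ⁴, t ↦ τ³` kills `F′ = x² − z³ − t⁴`. [folklore] -/
theorem aeval_F'_eq_zero :
    MvPolynomial.aeval (R := k) (![0, -(Polynomial.X ^ 4), Polynomial.X ^ 3] : Fin 3 → Polynomial k)
        (X 0 ^ 2 - X 1 ^ 3 - X 2 ^ 4 : MvPolynomial (Fin 3) k) = 0 := by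
  simp
  ring

/-- **THE CURVE STAGE.**  For `F′ = x² − z³ − t⁴ ∈ S′ = k[x,z,t]` and `a₁ = x̄ ∈ B₁ = S′/(F′)` (carried as variables
with their defining equations), the substitution `x ↦ 0, z ↦ −τ⁴, t ↦ τ³` descends to a ring map
`ψ : C₂ = B₁/(a₁) → k[τ]` which is INJECTIVE (kernel lemma `mem_span_of_test_eq_zero`) and whose image contains
`τ⁶·k[τ]` (image lemma): the data consumed by `…PersistenceConductorStable` for `t̄², z̄t̄, z̄² ∈ ca²(C₂)`.
[OURS · L1 w44b] -/
theorem exists_ringHom_curveStage (F : MvPolynomial (Fin 3) k) (hF : F = X 0 ^ 2 - X 1 ^ 3 - X 2 ^ 4)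
    (a₁ : MvPolynomial (Fin 3) k ⧸ Ideal.span ({F} : Set (MvPolynomial (Fin 3) k)))
    (ha₁ : a₁ = Ideal.Quotient.mk _ (X 0)) :
    ∃ ψ : (MvPolynomial (Fin 3) k ⧸ Ideal.span ({F} : Set (MvPolynomial (Fin 3) k))) ⧸ Ideal.span {a₁} →+*
        Polynomial k,
      Function.Injective ψ ∧
      (∀ g : MvPolynomial (Fin 3) k,
        ψ (Ideal.Quotient.mk _ (Ideal.Quotient.mk _ g)) =
          MvPolynomial.aeval (R := k) (![0, -(Polynomial.X ^ 4), Polynomial.X ^ 3] : Fin 3 → Polynomial k) g) ∧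
      ∀ d : Polynomial k, ∃ c', ψ c' = Polynomial.X ^ 6 * d := by
  subst hF
  -- the two descents
  set ψS : MvPolynomial (Fin 3) k →+* Polynomial k :=
    (MvPolynomial.aeval (R := k) (![0, -(Polynomial.X ^ 4), Polynomial.X ^ 3] : Fin 3 → Polynomial k)).toRingHom
    with hψS
  have hψS_apply : ∀ g, ψS g =
      MvPolynomial.aeval (R := k) (![0, -(Polynomial.X ^ 4), Polynomial.X ^ 3] : Fin 3 → Polynomial k) g :=
    fun g => rfl
  have hψSF : ∀ a ∈ Ideal.span ({X 0 ^ 2 - X 1 ^ 3 - X 2 ^ 4} : Set (MvPolynomial (Fin 3) k)), ψS a = 0 := by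
    intro a ha
    obtain ⟨v, rfl⟩ := Ideal.mem_span_singleton'.mp ha
    rw [map_mul, hψS_apply (X 0 ^ 2 - X 1 ^ 3 - X 2 ^ 4), aeval_F'_eq_zero, mul_zero]
  set ψB := Ideal.Quotient.lift _ ψS hψSF with hψB
  have hψB_mk : ∀ g, ψB (Ideal.Quotient.mk _ g) = ψS g := fun g => Ideal.Quotient.lift_mk _ _ _
  have hψBa₁ : ∀ a ∈ Ideal.span {a₁}, ψB a = 0 := by
    intro a ha
    obtain ⟨v, rfl⟩ := Ideal.mem_span_singleton'.mp ha
    rw [map_mul, ha₁, hψB_mk, hψS_apply]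
    simp
  set ψ := Ideal.Quotient.lift _ ψB hψBa₁ with hψ
  have hψ_mk : ∀ g : MvPolynomial (Fin 3) k, ψ (Ideal.Quotient.mk _ (Ideal.Quotient.mk _ g)) = ψS g := fun g => by
    rw [hψ, Ideal.Quotient.lift_mk, hψB_mk]
  -- the double quotient map `q = mk ∘ mk` kills `x`, `F′` and `z³ + t⁴` (all bookkeeping in `ker q ⊆ S′`)
  set q : MvPolynomial (Fin 3) k →+*
      (MvPolynomial (Fin 3) k ⧸ Ideal.span ({X 0 ^ 2 - X 1 ^ 3 - X 2 ^ 4} : Set (MvPolynomial (Fin 3) k))) ⧸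
        Ideal.span {a₁} := (Ideal.Quotient.mk _).comp (Ideal.Quotient.mk _) with hq
  have hq_apply : ∀ g, q g = Ideal.Quotient.mk _ (Ideal.Quotient.mk _ g) := fun g => rfl
  have hqX0 : (X 0 : MvPolynomial (Fin 3) k) ∈ RingHom.ker q := by
    rw [RingHom.mem_ker, hq_apply, ← ha₁, Ideal.Quotient.eq_zero_iff_mem]
    exact Ideal.mem_span_singleton_self a₁
  have hqF : (X 0 ^ 2 - X 1 ^ 3 - X 2 ^ 4 : MvPolynomial (Fin 3) k) ∈ RingHom.ker q := by
    rw [RingHom.mem_ker, hq_apply, Ideal.Quotient.eq_zero_iff_mem.mpr (Ideal.mem_span_singleton_self _), map_zero]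
  have hqh : (MvPolynomial.aeval (![X 1, X 2] : Fin 2 → MvPolynomial (Fin 3) k))
      (X 0 ^ 3 + X 1 ^ 4 : MvPolynomial (Fin 2) k) ∈ RingHom.ker q := by
    have h : (MvPolynomial.aeval (![X 1, X 2] : Fin 2 → MvPolynomial (Fin 3) k)) (X 0 ^ 3 + X 1 ^ 4 :
        MvPolynomial (Fin 2) k) = X 0 * X 0 - (X 0 ^ 2 - X 1 ^ 3 - X 2 ^ 4) := by
      simp
      ring
    rw [h]
    exact Ideal.sub_mem _ (Ideal.mul_mem_left _ _ hqX0) hqF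
  refine ⟨ψ, ?_, hψ_mk, ?_⟩
  · -- injectivity
    rw [injective_iff_map_eq_zero]
    intro u hu
    obtain ⟨u₀, rfl⟩ := Ideal.Quotient.mk_surjective u
    obtain ⟨g, rfl⟩ := Ideal.Quotient.mk_surjective u₀
    rw [hψ_mk, hψS_apply, ← test_comp_retraction₃, AlgHom.comp_apply] at hu
    -- `π′ g ∈ (z³ + t⁴)`, so `ι′ (π′ g) ∈ ker q`, and `g − ι′ (π′ g) ∈ (x) ⊆ ker q`
    obtain ⟨v, hv⟩ := Ideal.mem_span_singleton'.mp (mem_span_of_test_eq_zero k _ hu)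
    have h1 : (MvPolynomial.aeval (![X 1, X 2] : Fin 2 → MvPolynomial (Fin 3) k))
        ((MvPolynomial.aeval (![0, X 0, X 1] : Fin 3 → MvPolynomial (Fin 2) k)) g) ∈ RingHom.ker q := by
      rw [← hv, map_mul]
      exact Ideal.mul_mem_left _ _ hqh
    have h2 : g - (MvPolynomial.aeval (![X 1, X 2] : Fin 2 → MvPolynomial (Fin 3) k))
        ((MvPolynomial.aeval (![0, X 0, X 1] : Fin 3 → MvPolynomial (Fin 2) k)) g) ∈ RingHom.ker q := by
      have hle : Ideal.span ({X 0} : Set (MvPolynomial (Fin 3) k)) ≤ RingHom.ker q := by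
        rw [Ideal.span_le, Set.singleton_subset_iff]
        exact hqX0
      exact hle (sub_inclusion_retraction_mem₃ k g)
    have h3 : g ∈ RingHom.ker q := by simpa using Ideal.add_mem _ h2 h1
    rw [← hq_apply]
    exact h3
  · -- the image contains `τ⁶ · k[τ]`
    intro d
    obtain ⟨g₂, hg₂⟩ := exists_test_eq_X_pow_six_mul k d
    refine ⟨q ((MvPolynomial.aeval (![X 1, X 2] : Fin 2 → MvPolynomial (Fin 3) k)) g₂), ?_⟩
    rw [hq_apply, hψ_mk, hψS_apply, ← test_comp_retraction₃, AlgHom.comp_apply, retraction_comp_inclusion₃, hg₂]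

end CurveStage

end Summit.ResolutionOfSingularities.ResolutionOfSingularities.Theorems.HomologicalConductor.KC3Lower

end
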